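import Mathlib
import HarnessLib
import Literature.MathematicalPhysics.QuantumLattice.GaugeGroups
import Literature.MathematicalPhysics.QuantumFieldTheory.ConstructiveQFTWave0
import Summits.Ventures.LatticeQCDFlow.Scaling.LatticeEntropy
import Summits.Ventures.LatticeQCDFlow.Scaling.LatticeEntropyGrowthSharp

/-!
# The `SU(N)` instance of the entropy-growth law: typed, with its two one-plaquette inputs named

HONEST FRAMING: exact (Metropolis-corrected) sampling algorithms for lattice gauge theory;
figures of merit are autocorrelation/cost numbers at stated couplings and volumes; no
continuum-physics claim.

`entropyGrowth d κ` (`Scaling/LatticeEntropyGrowthSharp.lean`) proves, for the Wilson action of ANY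
compact second-countable group `G` in a continuous `N`-dimensional representation `ρ` with
`Re tr ρ ≤ N` on the torus `(ℤ/L)^d`, the two-sided law

  `κ·((d-1)·L^d·(1/2 - 1/L) - 1/2)·log β - C·L^d ≤ D(μ_{Λ,β} ‖ Haar^{⊗E})`
  `                                        ≤ κ·((d-1)·L^d + 1)/2·log β + C·L^d`

(`L ≥ 2`, `β ≥ 1`) conditionally on two one-plaquette inputs: (H1) `Z₁(β) ≤ A·β^{-κ/2}` (`β > 0`)
and (H2) measurable small balls `B_ε` (`0 < ε ≤ 1`) of Haar mass `≥ a·ε^κ` whose four-fold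
products from `{1} ∪ B_ε ∪ B_ε⁻¹` have plaquette action `≤ b·ε²`.  For `G = U(1)` both inputs are
PROVED (`Scaling/LatticeEntropyU1.lean`, `κ = 1`).  For `G = SU(N)` in the fundamental
representation (`Literature.MathematicalPhysics.QuantumLattice.fundamentalRep`, Haar probability
`haarProbability (Matrix.specialUnitaryGroup (Fin N) ℂ)`) the right exponent is the group dimension
`κ = N² - 1`, and both inputs are classical consequences of the Lie structure (exponential chart at
the identity, `N - Re tr e^X = ½‖X‖² + O(‖X‖⁴)` non-degenerate on `su(N)`; Weyl's integration
formula gives the exact one-plaquette asymptotics) — but NEITHER is available in Mathlib today (no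
Haar-measure asymptotics of small balls in a compact Lie group, no Weyl integration formula).

This file TYPES exactly what remains, so that the `SU(N)` law is a theorem with two named,
elementary-but-unformalised inputs and nothing else:

* `SUN.re_trace_le` (PROVED): `Re tr U ≤ N` on `SU(N)` (entries of a unitary matrix have norm
  `≤ 1`);
* `SUN.OnePlaquetteDecay N` (item, (H1) for `SU(N)`): `Z₁(β) ≤ A·β^{-(N²-1)/2}` for `β > 0`;
* `SUN.SmallBalls N` (item, (H2) for `SU(N)`): small balls of Haar mass `≥ a·ε^{N²-1}` with
  four-fold action `≤ b·ε²`;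
* `SUN.EntropyGrowthLaw d N` (item): the unconditional two-sided law above for `SU(N)` with
  `κ = N² - 1` — for `SU(3)` in `d = 4` the leading coefficient is `8·(3·L⁴)/2 = 12·L⁴` nats per
  unit of `log β`, the relative entropy every exact normalizing flow from the Haar prior must supply
  as `log M + log J` (`Scaling/EntropyBudget.lean`);
* `SUN.entropyGrowthLaw_of` (PROVED): `OnePlaquetteDecay N → SmallBalls N → EntropyGrowthLaw d N`
  (it is `entropyGrowth d (N²-1)` at `G = SU(N)`, `ρ = fundamentalRep`).

The sequel `Scaling/LatticeEntropySUNBalls.lean` PROVES both inputs from the two halves of ONE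
classical fact, the Haar-volume scaling `Haar{U : N - Re tr U ≤ r²} ≍ r^{N²-1}` of the action balls
(items `SUN.HaarActionBallLower/Upper`), so the `SU(N)` law rests on "`dim SU(N) = N² - 1`" alone.

`N ≥ 1` is a clause of each item (for `N = 0` they hold vacuously; for `N = 1` trivially,
`SU(1) = {1}`, `κ = 0`); `SU(N)` is given its second-countable topology instance here (a subspace
of `Fin N → Fin N → ℂ`; the other instances are the tree's, `GaugeGroups.lean`).
Nothing here is cited as a fact; the two inputs are obligations, not hypotheses smuggled into a
definition. [folklore]
-/

noncomputable section

open MeasureTheory Literature.MathematicalPhysics.QuantumFieldTheory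
open Literature.MathematicalPhysics.QuantumLattice (fundamentalRep fundamentalRep_apply
  continuous_fundamentalRep)

namespace Summit.Ventures.LatticeQCDFlow.Theory2.Lattice

namespace SUN

/-! ## 0. `SU(N)` is second countable -/

/-- `SU(N)` is second countable: it carries the subspace topology of the matrices
`Fin N → Fin N → ℂ`, a finite product of second-countable spaces. [folklore] -/
instance instSecondCountableTopologySU (N : ℕ) :
    SecondCountableTopology (Matrix.specialUnitaryGroup (Fin N) ℂ) :=
  haveI : SecondCountableTopology (Matrix (Fin N) (Fin N) ℂ) :=
    inferInstanceAs (SecondCountableTopology (Fin N → Fin N → ℂ))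
  Topology.IsEmbedding.subtypeVal.secondCountableTopology

/-! ## 1. The trace bound `Re tr U ≤ N` on `SU(N)` -/

/-- On `SU(N)` (fundamental representation) `Re tr U ≤ N`: every entry of a unitary matrix has
norm at most one (`entry_norm_bound_of_unitary`). [folklore] -/
theorem re_trace_le (N : ℕ) (U : Matrix.specialUnitaryGroup (Fin N) ℂ) :
    (fundamentalRep (Fin N) U).trace.re ≤ (N : ℝ) := by
  have hU : (U : Matrix (Fin N) (Fin N) ℂ) ∈ Matrix.unitaryGroup (Fin N) ℂ :=
    Matrix.specialUnitaryGroup_le_unitaryGroup U.2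
  rw [fundamentalRep_apply, Matrix.trace, Complex.re_sum]
  calc ∑ i, ((U : Matrix (Fin N) (Fin N) ℂ).diag i).re ≤ ∑ _i : Fin N, (1 : ℝ) :=
        Finset.sum_le_sum fun i _ =>
          (Complex.re_le_norm _).trans (entry_norm_bound_of_unitary hU i i)
    _ = N := by simp

/-! ## 2. The two one-plaquette inputs for `SU(N)`, as named obligations -/

/-- **(H1) for `SU(N)`**, `N ≥ 1` (one-plaquette partition function decay, `κ = N² - 1`): there is
`A` with `Z₁(β) = ∫_{SU(N)} e^{-β(N - Re tr U)} dU ≤ A·β^{-(N²-1)/2}` for all `β > 0`.  Classical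
(Laplace method at the unique minimum `U = 1` of `N - Re tr U`, a non-degenerate quadratic form
on the `(N²-1)`-dimensional Lie algebra; exact asymptotics by Weyl's integration formula); not in
Mathlib. [folklore] -/
@[conjecture] def OnePlaquetteDecay (N : ℕ) : Prop :=
  1 ≤ N → ∃ A : ℝ, ∀ β : ℝ, 0 < β →
    onePlaquetteZ (fundamentalRep (Fin N)) β ≤ A * β ^ (-(((N : ℝ) ^ 2 - 1) / 2))

/-- **(H2) for `SU(N)`**, `N ≥ 1` (small balls, `κ = N² - 1`): there are `a > 0` and `b` such that
for every `0 < ε ≤ 1` some measurable `B_ε ⊆ SU(N)` has Haar mass `≥ a·ε^{N²-1}` and every product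
of four elements of `{1} ∪ B_ε ∪ B_ε⁻¹` has plaquette action `N - Re tr ≤ b·ε²` (take `B_ε = exp`
of the `ε`-ball of `su(N)`).  Classical; not in Mathlib (no small-ball Haar asymptotics for compact
Lie groups). [folklore] -/
@[conjecture] def SmallBalls (N : ℕ) : Prop :=
  1 ≤ N → ∃ a b : ℝ, 0 < a ∧ ∀ ε : ℝ, 0 < ε → ε ≤ 1 →
    ∃ B : Set (Matrix.specialUnitaryGroup (Fin N) ℂ), MeasurableSet B ∧
      a * ε ^ ((N : ℝ) ^ 2 - 1) ≤
          ((haarProbability (Matrix.specialUnitaryGroup (Fin N) ℂ)) B).toReal ∧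
        ∀ g₁ ∈ insert (1 : Matrix.specialUnitaryGroup (Fin N) ℂ) (B ∪ B⁻¹),
          ∀ g₂ ∈ insert (1 : Matrix.specialUnitaryGroup (Fin N) ℂ) (B ∪ B⁻¹),
          ∀ g₃ ∈ insert (1 : Matrix.specialUnitaryGroup (Fin N) ℂ) (B ∪ B⁻¹),
          ∀ g₄ ∈ insert (1 : Matrix.specialUnitaryGroup (Fin N) ℂ) (B ∪ B⁻¹),
            (N : ℝ) - (fundamentalRep (Fin N) (g₁ * g₂ * g₃ * g₄)).trace.re ≤ b * ε ^ 2

/-! ## 3. The entropy-growth law of `SU(N)` lattice gauge theory -/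

/-- **Entropy growth of `SU(N)` lattice gauge theory**, `N ≥ 1` (Wilson action, fundamental
representation, torus `(ℤ/L)^d`, `κ = N² - 1`): there is `C = C(d, N)` such that for all `L ≥ 2`,
`β ≥ 1`: `(N²-1)·((d-1)L^d(1/2 - 1/L) - 1/2)·log β - C·L^d ≤ D(μ_{Λ,β} ‖ Haar^{⊗E})` and
`D(μ_{Λ,β} ‖ Haar^{⊗E}) ≤ (N²-1)·((d-1)L^d + 1)/2·log β + C·L^d`.  OPEN as a Lean theorem exactly
to the extent of `OnePlaquetteDecay N` and `SmallBalls N` (`entropyGrowthLaw_of`). [folklore] -/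
@[conjecture] def EntropyGrowthLaw (d N : ℕ) : Prop :=
  1 ≤ N → ∃ C : ℝ, ∀ (L : ℕ) [NeZero L], 2 ≤ L → ∀ β : ℝ, 1 ≤ β →
    ((N : ℝ) ^ 2 - 1) * (((d : ℝ) - 1) * (L : ℝ) ^ d * (1 / 2 - 1 / L) - 1 / 2) * Real.log β -
          C * (L : ℝ) ^ d ≤
        (InformationTheory.klDiv
            (wilsonMeasure (d := d) (L := L) (fundamentalRep (Fin N)) β)
            (Measure.pi fun _ : Edge d L =>
              haarProbability (Matrix.specialUnitaryGroup (Fin N) ℂ))).toReal ∧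
      (InformationTheory.klDiv
            (wilsonMeasure (d := d) (L := L) (fundamentalRep (Fin N)) β)
            (Measure.pi fun _ : Edge d L =>
              haarProbability (Matrix.specialUnitaryGroup (Fin N) ℂ))).toReal ≤
        ((N : ℝ) ^ 2 - 1) * ((((d : ℝ) - 1) * (L : ℝ) ^ d + 1) / 2) * Real.log β + C * (L : ℝ) ^ d

/-- **The `SU(N)` law from its two one-plaquette inputs**: `OnePlaquetteDecay N → SmallBalls N →
EntropyGrowthLaw d N`, in every dimension `d` — `entropyGrowth d (N² - 1)` at `G = SU(N)`,
`ρ = fundamentalRep (Fin N)` (continuous, `Re tr ≤ N` by `re_trace_le`). [folklore] -/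
theorem entropyGrowthLaw_of (d N : ℕ) (h1 : OnePlaquetteDecay N) (h2 : SmallBalls N) :
    EntropyGrowthLaw d N := fun hN =>
  entropyGrowth d ((N : ℝ) ^ 2 - 1) N (Matrix.specialUnitaryGroup (Fin N) ℂ)
    (fundamentalRep (Fin N)) (continuous_fundamentalRep (Fin N)) (re_trace_le N) (h1 hN) (h2 hN)

end SUN

end Summit.Ventures.LatticeQCDFlow.Theory2.Lattice

end
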